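import Summits.AtomisticToContinuum.Crystallization.Theorems.PricedLinkCensusLocalToGlobalThomsonKernel

/-!
# The regularised Newton kernel of `ℝ⁸`: representation off the core, scaling, gradient bounds

Route `PricedLinkCensus`, crux `LocalToGlobal` (stmt-AtomisticToContinuum-14232), line
`flux-cell-joint-census`, support for the registered stub `stub_confinedThomson : ConfinedThomson`;
continues `PricedLinkCensusLocalToGlobalThomsonKernel` (`f_t = newtonFar8 t = (1 - θ_t)‖·‖⁻⁶`,
`∫ Δ f_t = -2π⁴`).  Contents:

* `integral_laplacian_newtonFar8_mul_newtonFar8` — **representation off the core**: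
  `∫ Δf_t(x) f_t(y + x) dx = -2π⁴ ‖y‖⁻⁶` for `‖y‖ ≥ 3t` (the tree's local weighted mean value property
  `Literature.Analysis.FluidPDE.integral_radial_mul_eq_of_laplacian_eq_zero` for the radial weight `Δ f_t`,
  which lives in `B̄(0,2t)`, against `f_t(y + ·) = ‖y + ·‖⁻⁶`, harmonic on `B(0, 2t)`);
* `newtonFar8_scale`, `laplacian_newtonFar8_scale`, `integral_abs_laplacian_newtonFar8` — the dilation
  structure `f_t(z) = t⁻⁶ f₁(z/t)`, `Δf_t(z) = t⁻⁸(Δf₁)(z/t)`, `∫|Δf_t| = ∫|Δf₁|`, and the kernel bound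
  `|∫ Δf_t(x) f_t(y + x) dx| ≤ 64 t⁻⁶ ∫|Δf₁|`;
* the gradient `Df_t(z) = 2g′(‖z‖²)⟨z,·⟩`, `‖Df_t(z)‖ = 6‖z‖⁻⁷` for `‖z‖ > t`, and the global weighted
  bounds `|f_t(z)| ≤ (1 + 2/t)⁶ (1 + ‖z‖)⁻⁶`, `‖Df_t(z)‖ ≤ A (1 + ‖z‖)⁻⁷` used for the `L²` decay of
  the potentials `f_t ∗ ρ` and their gradients;
* local integrability of the Newton kernel `‖·‖⁻⁶` of `ℝ⁸` (`6 < 8`): `∫_{B(0,r)} ‖u‖⁻⁶ du = (π⁴/6) r²`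
  (polar coordinates), the translates `w ↦ ‖x - w‖⁻⁶` are integrable on every ball with the UNIFORM bound
  `∫_{B(c,r)} ‖x - w‖⁻⁶ dw ≤ (3π⁴/2) r²`.

References: D. Gilbarg, N. S. Trudinger, *Elliptic PDE of second order* (2001), Thm 2.1, (2.12)–(2.18);
E. H. Lieb, M. Loss, *Analysis* (2001), Thm 6.20, §9.7.
-/

noncomputable section

open MeasureTheory Set Filter Metric Topology InnerProductSpace Function
open scoped RealInnerProductSpace Laplacian ContDiff
open Literature.Analysis.FluidPDE (cutoffProfile cutoffProfile_contDiff cutoffProfile_nonneg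
  cutoffProfile_le_one cutoffProfile_eq_one cutoffProfile_eq_zero laplacian_comp_norm_sq
  hasFDerivAt_comp_norm_sq fderiv_comp_norm_sq_apply)

namespace Summit.AtomisticToContinuum.Crystallization.Theorems.PricedLinkCensusLocalToGlobal

variable {t : ℝ}

/-! ### Representation off the core (weighted mean value property) -/

/-- **Representation off the core**: for `‖y‖ ≥ 3t`,
`∫ Δf_t(x) · f_t(y + x) dx = (∫ Δ f_t) · f_t(y) = -2π⁴ ‖y‖⁻⁶` — the radial weight `Δ f_t` lives in
`B̄(0, 2t)` and `f_t(y + ·) = ‖y + ·‖⁻⁶` is harmonic on `B(0, 2t)` (the tree's local weighted mean value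
property, Gilbarg–Trudinger Thm 2.1).  This is the convolution identity `(Δf_t) ∗ f_t = -2π⁴ ‖·‖⁻⁶` off
`B(0, 3t)`. [cite: GilbargTrudinger2001, Thm 2.1] -/
theorem integral_laplacian_newtonFar8_mul_newtonFar8 (ht : 0 < t) {y : E8} (hy : 3 * t ≤ ‖y‖) :
    ∫ x, (Δ (newtonFar8 t)) x * newtonFar8 t (y + x) = -(2 * Real.pi ^ 4) * ‖y‖⁻¹ ^ 6 := by
  have hΔ : ∀ x ∈ ball y (2 * t), (Δ (newtonFar8 t)) x = 0 := fun x hx => by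
    refine laplacian_newtonFar8_eq_zero_of_gt ht ?_
    rw [mem_ball, dist_eq_norm] at hx
    have h1 : ‖y‖ ≤ ‖x - y‖ + ‖x‖ := by
      calc ‖y‖ = ‖x - (x - y)‖ := by abel_nf
        _ ≤ ‖x‖ + ‖x - y‖ := norm_sub_le _ _
        _ = ‖x - y‖ + ‖x‖ := add_comm _ _
    linarith
  have h := Literature.Analysis.FluidPDE.integral_radial_mul_eq_of_laplacian_eq_zero
    (contDiff_newtonFar8 ht (n := 2)) (x₀ := y) (by linarith : 0 < 2 * t) hΔ
    (continuous_laplacian_newtonFar8 ht) (fun x hx => laplacian_newtonFar8_eq_zero_of_le ht hx)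
    (fun x x' hxx' => laplacian_newtonFar8_radial ht hxx')
  rw [h, integral_laplacian_newtonFar8 ht, newtonFar8_eq_of_le ht (by linarith)]

/-! ### Scaling `f_t(z) = t⁻⁶ f₁(z/t)` and the uniform `L¹` bound on `Δ f_t` -/

/-- `f_t(z) = t⁻⁶ f₁(t⁻¹ z)`. [folklore] -/
theorem newtonFar8_scale (ht : 0 < t) (z : E8) : newtonFar8 t z = (t ^ 6)⁻¹ * newtonFar8 1 (t⁻¹ • z) := by
  have hθ : cutoffProfile (t / 2) t (‖z‖ ^ 2) = cutoffProfile (1 / 2) 1 (‖t⁻¹ • z‖ ^ 2) := by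
    have h := Literature.Analysis.FluidPDE.radialCutoff_scale (r₀ := 1 / 2) (r₁ := 1) ht z
    rw [mul_one, show t * (1 / 2) = t / 2 by ring] at h
    exact h
  have hn : ‖t⁻¹ • z‖ ^ 2 = (t ^ 2)⁻¹ * ‖z‖ ^ 2 := by
    rw [norm_smul, norm_inv, Real.norm_eq_abs, abs_of_pos ht, mul_pow, inv_pow]
  rw [newtonFar8, newtonFar8, farProfile8, farProfile8, ← hθ, hn, mul_zpow, inv_zpow', neg_neg, zpow_ofNat,
    ← pow_mul]
  norm_num
  field_simp

/-- `f_t = z ↦ t⁻⁶ • f₁(t⁻¹ • z)`, function form. [folklore] -/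
theorem newtonFar8_eq_scale (ht : 0 < t) : newtonFar8 t = fun z : E8 => (t ^ 6)⁻¹ • newtonFar8 1 (t⁻¹ • z) :=
  funext fun z => by rw [smul_eq_mul]; exact newtonFar8_scale ht z

/-- `Δ f_t(z) = t⁻⁸ (Δ f₁)(t⁻¹ z)` (dilation calculus for the Laplacian). [folklore] -/
theorem laplacian_newtonFar8_scale (ht : 0 < t) (z : E8) :
    (Δ (newtonFar8 t)) z = (t ^ 8)⁻¹ * (Δ (newtonFar8 1)) (t⁻¹ • z) := by
  rw [newtonFar8_eq_scale ht, Literature.Analysis.FluidPDE.laplacian_const_smul_comp_smul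
    (newtonFar8 1) ((t ^ 6)⁻¹) (inv_ne_zero ht.ne') z, smul_eq_mul]
  congr 1
  field_simp

/-- **Uniform `L¹` bound**: `∫ |Δ f_t| = ∫ |Δ f₁|` for every `t > 0`. [folklore] -/
theorem integral_abs_laplacian_newtonFar8 (ht : 0 < t) :
    ∫ z, |(Δ (newtonFar8 t)) z| = ∫ z, |(Δ (newtonFar8 1)) z| := by
  have h1 : (fun z : E8 => |(Δ (newtonFar8 t)) z|) = fun z => (t ^ 8)⁻¹ * |(Δ (newtonFar8 1)) (t⁻¹ • z)| := by
    funext z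
    rw [laplacian_newtonFar8_scale ht z, abs_mul, abs_of_pos (by positivity)]
  have h2 := Measure.integral_comp_smul (volume : Measure E8) (fun z => |(Δ (newtonFar8 1)) z|) t⁻¹
  simp only [finrank_euclideanSpace_fin, smul_eq_mul] at h2
  rw [h1, integral_const_mul, h2, inv_pow, inv_inv, abs_of_pos (pow_pos ht 8), ← mul_assoc,
    inv_mul_cancel₀ (pow_ne_zero 8 ht.ne'), one_mul]

/-- `∫ |Δ f₁| > 0`... we only need it is a finite real; name it: the `L¹` norm of `Δ f₁`. [folklore] -/
theorem integral_abs_laplacian_newtonFar8_nonneg : 0 ≤ ∫ z, |(Δ (newtonFar8 1)) z| :=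
  integral_nonneg fun _ => abs_nonneg _

/-- **Sup bound**: `|f_t(z)| ≤ 64 t⁻⁶` everywhere (`f_t = 0` on `B(0, t/2)`, `f_t ≤ ‖z‖⁻⁶ ≤ (t/2)⁻⁶` off it). [folklore] -/
theorem abs_newtonFar8_le_const (ht : 0 < t) (z : E8) : |newtonFar8 t z| ≤ 64 * (t ^ 6)⁻¹ := by
  rcases le_or_gt ‖z‖ (t / 2) with hz | hz
  · rw [newtonFar8_eq_zero ht hz, abs_zero]; positivity
  · refine (abs_newtonFar8_le t z).trans ?_
    rw [inv_pow, show (64 : ℝ) * (t ^ 6)⁻¹ = ((t / 2) ^ 6)⁻¹ by rw [div_pow]; norm_num; field_simp]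
    exact inv_anti₀ (by positivity) (pow_le_pow_left₀ (by positivity) hz.le 6)

/-- **Kernel bound for the convolution `(Δf_t) ∗ f_t`**: `|∫ Δf_t(x) f_t(y + x) dx| ≤ 64 t⁻⁶ ∫|Δ f₁|`. [folklore] -/
theorem abs_integral_laplacian_newtonFar8_mul_le (ht : 0 < t) (y : E8) :
    |∫ x, (Δ (newtonFar8 t)) x * newtonFar8 t (y + x)| ≤ 64 * (t ^ 6)⁻¹ * ∫ z, |(Δ (newtonFar8 1)) z| := by
  rw [← integral_abs_laplacian_newtonFar8 ht, ← integral_const_mul]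
  refine (abs_integral_le_integral_abs).trans (integral_mono_of_nonneg (Eventually.of_forall fun _ => abs_nonneg _)
    (((integrable_laplacian_newtonFar8 ht).abs).const_mul _) (Eventually.of_forall fun x => ?_))
  simp only
  rw [abs_mul, mul_comm (64 * (t ^ 6)⁻¹)]
  exact mul_le_mul_of_nonneg_left (abs_newtonFar8_le_const ht _) (abs_nonneg _)

/-! ### The gradient of `f_t` -/

/-- `f_t` has derivative `2 g_t′(‖z‖²) ⟨z, ·⟩` at `z`. [folklore] -/
theorem hasFDerivAt_newtonFar8 (ht : 0 < t) (z : E8) :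
    HasFDerivAt (newtonFar8 t) ((2 * farProfile8₁ t (‖z‖ ^ 2)) • (innerSL ℝ z : E8 →L[ℝ] ℝ)) z :=
  hasFDerivAt_comp_norm_sq (hasDerivAt_farProfile8 ht (‖z‖ ^ 2))

/-- `‖D f_t(z)‖ = 2 |g_t′(‖z‖²)| ‖z‖`. [folklore] -/
theorem norm_fderiv_newtonFar8 (ht : 0 < t) (z : E8) :
    ‖fderiv ℝ (newtonFar8 t) z‖ = 2 * |farProfile8₁ t (‖z‖ ^ 2)| * ‖z‖ := by
  rw [(hasFDerivAt_newtonFar8 ht z).fderiv, norm_smul, innerSL_apply_norm, Real.norm_eq_abs, abs_mul,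
    abs_of_pos (by norm_num : (0 : ℝ) < 2)]

/-- **Far gradient**: `‖D f_t(z)‖ = 6 ‖z‖⁻⁷` for `‖z‖ > t` (`= ‖∇‖·‖⁻⁶‖`). [folklore] -/
theorem norm_fderiv_newtonFar8_of_gt (ht : 0 < t) {z : E8} (hz : t < ‖z‖) :
    ‖fderiv ℝ (newtonFar8 t) z‖ = 6 * ‖z‖⁻¹ ^ 7 := by
  have hz0 : 0 < ‖z‖ := ht.trans hz
  have hσ : t ^ 2 < ‖z‖ ^ 2 := by gcongr
  rw [norm_fderiv_newtonFar8 ht, farProfile8₁_eq ht hσ, abs_mul, abs_of_neg (by norm_num : (-3 : ℝ) < 0),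
    abs_of_pos (zpow_pos (pow_pos hz0 2) _), zpow_neg, zpow_ofNat, ← pow_mul, inv_pow]
  field_simp
  ring

/-- Elementary: `s⁻¹ ≤ (1 + c)(1 + s)⁻¹` as soon as `c s ≥ 1` (`s > 0`). [folklore] -/
theorem inv_le_mul_inv_one_add {s c : ℝ} (hs : 0 < s) (h : 1 ≤ c * s) :
    s⁻¹ ≤ (1 + c) * (1 + s)⁻¹ := by
  rw [inv_eq_one_div, inv_eq_one_div, mul_one_div, div_le_div_iff₀ hs (by positivity)]
  nlinarith

/-- **Global weighted bound on `f_t`**: `|f_t(z)| ≤ (1 + 2/t)⁶ (1 + ‖z‖)⁻⁶`. [folklore] -/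
theorem abs_newtonFar8_le_weight (ht : 0 < t) (z : E8) :
    |newtonFar8 t z| ≤ (1 + 2 / t) ^ 6 * (1 + ‖z‖)⁻¹ ^ 6 := by
  rcases le_or_gt ‖z‖ (t / 2) with hz | hz
  · rw [newtonFar8_eq_zero ht hz, abs_zero]; positivity
  · refine (abs_newtonFar8_le t z).trans ?_
    have hz0 : 0 < ‖z‖ := (half_pos ht).trans hz
    have h3 : 1 ≤ 2 / t * ‖z‖ := by
      rw [div_mul_eq_mul_div, le_div_iff₀ ht]; linarith
    rw [← mul_pow]
    exact pow_le_pow_left₀ (inv_nonneg.2 (norm_nonneg _)) (inv_le_mul_inv_one_add hz0 h3) 6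

/-- **Global weighted bound on the gradient**: `‖D f_t(z)‖ ≤ A (1 + ‖z‖)⁻⁷` for some `A ≥ 0` (bounded on
`B̄(0,t)` by continuity, `= 6‖z‖⁻⁷` beyond). [folklore] -/
theorem exists_norm_fderiv_newtonFar8_le_weight (ht : 0 < t) :
    ∃ A : ℝ, 0 ≤ A ∧ ∀ z : E8, ‖fderiv ℝ (newtonFar8 t) z‖ ≤ A * (1 + ‖z‖)⁻¹ ^ 7 := by
  obtain ⟨M, hM⟩ := (isCompact_closedBall (0 : E8) t).exists_bound_of_continuousOn
    (((contDiff_newtonFar8 ht (n := 1)).continuous_fderiv one_ne_zero).continuousOn)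
  refine ⟨max (max M 0 * (1 + t) ^ 7) (6 * (1 + t⁻¹) ^ 7), le_max_of_le_left (by positivity), fun z => ?_⟩
  rcases le_or_gt ‖z‖ t with hz | hz
  · have h1 : ‖fderiv ℝ (newtonFar8 t) z‖ ≤ max M 0 := (hM z (mem_closedBall_zero_iff.2 hz)).trans (le_max_left _ _)
    have h2 : (1 : ℝ) ≤ (1 + t) ^ 7 * (1 + ‖z‖)⁻¹ ^ 7 := by
      rw [← mul_pow, inv_eq_one_div, mul_one_div]
      exact one_le_pow₀ ((one_le_div (by positivity)).2 (by linarith))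
    calc ‖fderiv ℝ (newtonFar8 t) z‖ ≤ max M 0 * 1 := by rw [mul_one]; exact h1
      _ ≤ max M 0 * ((1 + t) ^ 7 * (1 + ‖z‖)⁻¹ ^ 7) := mul_le_mul_of_nonneg_left h2 (le_max_right _ _)
      _ = max M 0 * (1 + t) ^ 7 * (1 + ‖z‖)⁻¹ ^ 7 := by ring
      _ ≤ _ := mul_le_mul_of_nonneg_right (le_max_left _ _) (by positivity)
  · have hz0 : 0 < ‖z‖ := ht.trans hz
    rw [norm_fderiv_newtonFar8_of_gt ht hz]
    have h2 : ‖z‖⁻¹ ^ 7 ≤ (1 + t⁻¹) ^ 7 * (1 + ‖z‖)⁻¹ ^ 7 := by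
      rw [← mul_pow]
      refine pow_le_pow_left₀ (by positivity) (inv_le_mul_inv_one_add hz0 ?_) 7
      rw [← div_eq_inv_mul, one_le_div ht]
      exact hz.le
    calc 6 * ‖z‖⁻¹ ^ 7 ≤ 6 * ((1 + t⁻¹) ^ 7 * (1 + ‖z‖)⁻¹ ^ 7) := by gcongr
      _ = 6 * (1 + t⁻¹) ^ 7 * (1 + ‖z‖)⁻¹ ^ 7 := by ring
      _ ≤ _ := mul_le_mul_of_nonneg_right (le_max_right _ _) (by positivity)

/-! ## Local integrability of the Newton kernel `‖·‖⁻⁶` of `ℝ⁸` -/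

/-! ### `‖·‖⁻⁶` is integrable on balls of `ℝ⁸` -/

/-- `‖·‖⁻⁶` is integrable on every ball `B(0, r)` of `ℝ⁸` (in polar coordinates the integrand is `s⁷ s⁻⁶ = s`). [folklore] -/
theorem integrableOn_inv_norm_pow_six_ball (r : ℝ) : IntegrableOn (fun u : E8 => ‖u‖⁻¹ ^ 6) (ball 0 r) := by
  have h := (integrableOn_fun_norm_addHaar (volume : Measure E8) (f := fun y : ℝ => y⁻¹ ^ 6) (r := r)).2 ?_
  · exact h
  · rw [finrank_euclideanSpace_fin]
    refine (continuous_id.integrableOn_Icc.mono_set Ioo_subset_Icc_self).congr_fun (fun y hy => ?_)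
      measurableSet_Ioo
    have hy0 : (y : ℝ) ≠ 0 := ne_of_gt hy.1
    simp only [id, smul_eq_mul]
    field_simp

/-- **`∫_{B(0,r)} ‖u‖⁻⁶ du = (π⁴/6) r²`** in `ℝ⁸` (`= 8 · vol B₁ · r²/2`, `vol B₁ = π⁴/24`). [cite: Folland1999, Cor. 2.51] -/
theorem setIntegral_inv_norm_pow_six_ball {r : ℝ} (hr : 0 ≤ r) :
    ∫ u in ball (0 : E8) r, ‖u‖⁻¹ ^ 6 = Real.pi ^ 4 / 6 * r ^ 2 := by
  have hind : (ball (0 : E8) r).indicator (fun u : E8 => ‖u‖⁻¹ ^ 6) =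
      fun u : E8 => (Iio r).indicator (fun s : ℝ => s⁻¹ ^ 6) ‖u‖ := by
    funext u
    by_cases hu : ‖u‖ < r
    · simp [indicator, hu]
    · simp [indicator, hu]
  rw [← integral_indicator measurableSet_ball, hind,
    integral_fun_norm_addHaar (volume : Measure E8) (fun s : ℝ => (Iio r).indicator (fun s : ℝ => s⁻¹ ^ 6) s),
    finrank_euclideanSpace_fin, volume_real_ball_E8]
  have hinner : ∫ s in Ioi (0 : ℝ), s ^ (8 - 1) • (Iio r).indicator (fun s : ℝ => s⁻¹ ^ 6) s = r ^ 2 / 2 := by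
    have h1 : EqOn (fun s : ℝ => s ^ (8 - 1) • (Iio r).indicator (fun s : ℝ => s⁻¹ ^ 6) s)
        ((Iio r).indicator fun s : ℝ => s) (Ioi 0) := by
      intro s hs
      have hs0 : (s : ℝ) ≠ 0 := ne_of_gt hs
      by_cases hsr : s < r
      · simp only [indicator, mem_Iio, hsr, if_true, smul_eq_mul]
        field_simp
      · simp [indicator, hsr]
    rw [setIntegral_congr_fun measurableSet_Ioi h1, setIntegral_indicator measurableSet_Iio,
      show Ioi (0 : ℝ) ∩ Iio r = Ioo 0 r from rfl,
      show ∫ s in Ioo (0 : ℝ) r, s = ∫ s in Ioc (0 : ℝ) r, s from (integral_Ioc_eq_integral_Ioo).symm,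
      ← intervalIntegral.integral_of_le hr, integral_id]
    ring
  rw [hinner]
  simp only [nsmul_eq_mul, smul_eq_mul]
  push_cast
  ring

/-- `‖·‖⁻⁶` is integrable on every ball of `ℝ⁸` (any centre: `B(a, r) ⊆ B(0, ‖a‖ + r)`). [folklore] -/
theorem integrableOn_inv_norm_pow_six_ball' (a : E8) (r : ℝ) :
    IntegrableOn (fun u : E8 => ‖u‖⁻¹ ^ 6) (ball a r) :=
  (integrableOn_inv_norm_pow_six_ball (‖a‖ + r)).mono_set
    (ball_subset_ball' (by rw [dist_zero_right, add_comm]))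

/-- The reflection-translation `w ↦ x - w` pulls `B(x - c, r)` back to `B(c, r)`. [folklore] -/
theorem preimage_sub_left_ball (x c : E8) (r : ℝ) : (fun w : E8 => x - w) ⁻¹' ball (x - c) r = ball c r := by
  ext w
  simp only [mem_preimage, mem_ball, dist_eq_norm]
  rw [show x - w - (x - c) = -(w - c) by abel, norm_neg]

/-- The translates `w ↦ ‖x - w‖⁻⁶` are integrable on every ball `B(c, r)`. [folklore] -/
theorem integrableOn_inv_norm_sub_pow_six (x c : E8) (r : ℝ) :
    IntegrableOn (fun w : E8 => ‖x - w‖⁻¹ ^ 6) (ball c r) := by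
  have hmp := Measure.measurePreserving_sub_left (volume : Measure E8) x
  have hemb : MeasurableEmbedding (fun w : E8 => x - w) := (MeasurableEquiv.subLeft x).measurableEmbedding
  have h := (hmp.integrableOn_comp_preimage hemb (f := fun u : E8 => ‖u‖⁻¹ ^ 6) (s := ball (x - c) r)).2
    (integrableOn_inv_norm_pow_six_ball' (x - c) r)
  rwa [preimage_sub_left_ball] at h

/-- Change of variables: `∫_{B(c,r)} ‖x - w‖⁻⁶ dw = ∫_{B(x-c,r)} ‖u‖⁻⁶ du`. [folklore] -/
theorem setIntegral_inv_norm_sub_pow_six_eq (x c : E8) (r : ℝ) :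
    ∫ w in ball c r, ‖x - w‖⁻¹ ^ 6 = ∫ u in ball (x - c) r, ‖u‖⁻¹ ^ 6 := by
  have hmp := Measure.measurePreserving_sub_left (volume : Measure E8) x
  have hemb : MeasurableEmbedding (fun w : E8 => x - w) := (MeasurableEquiv.subLeft x).measurableEmbedding
  rw [← preimage_sub_left_ball x c r]
  exact hmp.setIntegral_preimage_emb hemb (fun u : E8 => ‖u‖⁻¹ ^ 6) (ball (x - c) r)

/-- `vol B(a, r) = (π⁴/24) r⁸` in `ℝ⁸`. [folklore] -/
theorem volume_real_ball_E8' (a : E8) {r : ℝ} (hr : 0 ≤ r) :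
    (volume : Measure E8).real (ball a r) = Real.pi ^ 4 / 24 * r ^ 8 := by
  rw [measureReal_def, Measure.addHaar_ball volume a hr, ENNReal.toReal_mul, finrank_euclideanSpace_fin,
    ENNReal.toReal_ofReal (by positivity), ← measureReal_def, volume_real_ball_E8]
  ring

/-- **Uniform bound**: `∫_{B(c,r)} ‖x - w‖⁻⁶ dw ≤ (3π⁴/2) r²` for every `x` (near centres `‖x - c‖ ≤ 2r`:
`B(x - c, r) ⊆ B(0, 3r)` and `(π⁴/6)(3r)² = 3π⁴r²/2`; far centres: the integrand is `≤ r⁻⁶` on a ball of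
volume `(π⁴/24) r⁸`). [folklore] -/
theorem setIntegral_inv_norm_sub_pow_six_le (x c : E8) {r : ℝ} (hr : 0 ≤ r) :
    ∫ w in ball c r, ‖x - w‖⁻¹ ^ 6 ≤ 3 / 2 * Real.pi ^ 4 * r ^ 2 := by
  rcases hr.eq_or_lt with h0 | hr0
  · rw [← h0, ball_zero, Measure.restrict_empty, integral_zero_measure]; norm_num
  rw [setIntegral_inv_norm_sub_pow_six_eq]
  rcases le_or_gt ‖x - c‖ (2 * r) with hxc | hxc
  · -- near: enlarge the ball
    have hsub : ball (x - c) r ⊆ ball (0 : E8) (3 * r) :=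
      ball_subset_ball' (by rw [dist_zero_right]; linarith)
    calc ∫ u in ball (x - c) r, ‖u‖⁻¹ ^ 6 ≤ ∫ u in ball (0 : E8) (3 * r), ‖u‖⁻¹ ^ 6 :=
          setIntegral_mono_set (integrableOn_inv_norm_pow_six_ball _)
            (Eventually.of_forall fun u => by positivity) (Eventually.of_forall hsub)
      _ = Real.pi ^ 4 / 6 * (3 * r) ^ 2 := setIntegral_inv_norm_pow_six_ball (by linarith)
      _ = 3 / 2 * Real.pi ^ 4 * r ^ 2 := by ring
  · -- far: the integrand is at most `r⁻⁶`
    have hbound : ∀ u ∈ ball (x - c) r, ‖u‖⁻¹ ^ 6 ≤ r⁻¹ ^ 6 := fun u hu => by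
      rw [mem_ball, dist_eq_norm] at hu
      have h1 : r ≤ ‖u‖ := by
        have := norm_sub_norm_le (x - c) u
        rw [show ‖x - c - u‖ = ‖u - (x - c)‖ from norm_sub_rev _ _] at this
        linarith
      exact pow_le_pow_left₀ (by positivity) (inv_anti₀ hr0 h1) 6
    calc ∫ u in ball (x - c) r, ‖u‖⁻¹ ^ 6 ≤ ∫ _ in ball (x - c) r, r⁻¹ ^ 6 :=
          setIntegral_mono_on (integrableOn_inv_norm_pow_six_ball' _ _) (integrableOn_const measure_ball_lt_top.ne)
            measurableSet_ball hbound
      _ = Real.pi ^ 4 / 24 * r ^ 8 * r⁻¹ ^ 6 := by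
          rw [setIntegral_const, smul_eq_mul, volume_real_ball_E8' _ hr]
      _ = Real.pi ^ 4 / 24 * r ^ 2 := by field_simp
      _ ≤ 3 / 2 * Real.pi ^ 4 * r ^ 2 := by nlinarith [pow_pos Real.pi_pos 4, sq_nonneg r]

/-- **Registered sub-goal `newtonFar8_representation`** (line `flux-cell-joint-census`, support of
`stub_confinedThomson`): the representation off the core, binder form of
`integral_laplacian_newtonFar8_mul_newtonFar8`. [cite: GilbargTrudinger2001, Thm 2.1] -/
theorem newtonFar8_representation : ∀ t : ℝ, 0 < t → ∀ y : E8, 3 * t ≤ ‖y‖ →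
    ∫ x, (Δ (newtonFar8 t)) x * newtonFar8 t (y + x) = -(2 * Real.pi ^ 4) * ‖y‖⁻¹ ^ 6 :=
  fun _ ht _ hy => integral_laplacian_newtonFar8_mul_newtonFar8 ht hy

end Summit.AtomisticToContinuum.Crystallization.Theorems.PricedLinkCensusLocalToGlobal

end
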